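import Literature.Barriers.SmoothPoincare4.StableInvariantsBlind
import Literature.Topology.FourManifolds.HCobordismEvenLevelsChain
import Literature.Topology.FourManifolds.ThetaFourWall
import HarnessLib

/-!
# `StableBarrierFour` from `Θ₄ = 0` and the oddness of the twisted surgery alone

Sibling proof file of `Literature/Barriers/SmoothPoincare4/StableInvariantsBlind.lean` (barrier
`Literature.Barriers.SmoothPoincare4.StableBarrierFour`: no invariant of the `S² × S²`-stable
diffeomorphism type — in particular no semisimple 4-dimensional TFT, Reutter 2023 Thm. 1,
Reutter–Schommer-Pries 2022 Thm. A — distinguishes a homotopy 4-sphere from `S⁴`).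

The barrier is Wall's Theorem 3 for the pair `(Σ, S⁴)` plus `Θ₄ = 0` (Kervaire–Milnor 1963):
`Σ # k(S² × S²) ≅ # k(S² × S²)`.  The tree vendors both as named facts and reduces Wall's
theorem to the middle-level statement K1′, and K1′ to the untwistedness of the level passages
(`HCobordismMiddleLevelChain.lean`).  For the ends that occur here — homotopy 4-spheres, whose
`H²(·; ℤ)/T` vanishes, so that their intersection forms are even — the level-parity theorem
(`HCobordismEvenLevels.lean`: every regular level of an h-cobordism between even simply
connected closed 4-manifolds is even, Kirby 1989 Ch. X p. 55 "because `W` is spin" proved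
homologically) and the chain run with it (`HCobordismEvenLevelsChain.lean`) leave exactly ONE
local input besides `Θ₄ = 0`:

> (`hodd`) the surgery on a simply connected closed smooth 4-manifold `V` along the standard
> circle of a chart with the *twisted* standard tube, `(C.nbhd.linTwist OpLoop.twist).Surgered`
> (`≅ V # S² ×~ S² ≅ V # ℂℙ² # \overline{ℂℙ²}`), has an odd intersection form.

PROVED here:

* `isEven_intersectionForm_of_subsingleton_freeCohomology` — a 4-manifold with
  `H²(·; ℤ)/T = 0` has even (zero) intersection form;
* `exists_isStabilization_sphere_of_homotopySphere_four_of_thetaFour_of_isOdd_twist` — every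
  homotopy 4-sphere has a common stabilisation with `S⁴`, GIVEN `Θ₄ = 0`
  (`Literature.Topology.FourManifolds.isHCobordant_sphere_of_homotopySphere_four`) and `hodd`;
* **`stableBarrierFour_of_thetaFour_of_isOdd_twist`** — `StableBarrierFour` GIVEN `Θ₄ = 0` and
  `hodd` (compare `stableBarrierFour_of_wall`, which takes Wall's Theorem 3 whole).

No named fact is introduced; `hodd` is a hypothesis.

## References

* R. C. Kirby, *The Topology of 4-Manifolds*, LNM 1374 (1989), Ch. X pp. 55–56. [Kirby1989]
* C. T. C. Wall, *On simply-connected 4-manifolds*, J. London Math. Soc. 39 (1964), Thm. 3.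
  [WallJLMS1964]
* M. Kervaire, J. Milnor, *Groups of homotopy spheres I*, Ann. of Math. 77 (1963), Thm. 1.1.
  [KervaireMilnorAnnals1963]
* D. Reutter, *Semisimple 4-dimensional topological field theories cannot detect exotic smooth
  structure*, J. Topol. 16 (2023), Thm. 1. [Reutter2023SemisimpleTFT]
* D. Reutter, C. Schommer-Pries, *Semisimple field theories detect stable diffeomorphism*,
  arXiv:2206.10031 (2022), Thm. A. [ReutterSchommerPries2022]
-/

noncomputable section

open scoped Manifold ContDiff
open Set Literature.Topology.FourManifolds Literature.AlgebraicTopology.SingularHomology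

namespace Literature.Barriers.SmoothPoincare4

universe u

/-- **A 4-manifold with `H²(·; ℤ)/T = 0` has even intersection form** (the zero form on the zero
module; homotopy 4-spheres and `S⁴`, `ThetaFourWall.lean`). [cite: MilnorHusemoller1973, §V.1] -/
theorem isEven_intersectionForm_of_subsingleton_freeCohomology {X : Type} [TopologicalSpace X]
    [Subsingleton ↥(freeCohomology ℤ X 2)] (μ : HomologicalOrientation ℤ X 4) :
    (intersectionForm two_add_two_eq_four μ).IsEven := fun x => by
  rw [Subsingleton.elim x 0, map_zero]
  exact Even.zero

/-- **Every homotopy 4-sphere is stably diffeomorphic to `S⁴`, GIVEN `Θ₄ = 0` and the oddness of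
the twisted surgery** (Wall 1964, Thm. 3 with Kervaire–Milnor 1963, Thm. 1.1): the h-cobordism
`Σ ∼ S⁴` of `Θ₄ = 0` (`isHCobordant_sphere_of_homotopySphere_four`) has as middle level a common
`k`-fold stabilisation of `Σ` and `S⁴`
(`exists_isStabilization_of_isHCobordant_of_isEven_of_isOdd_twist`, the ends being even for want
of classes in `H²/T`; `π₁(S⁴) = 1` is `simplyConnectedSpace_sphere_four_holds`).
[cite: WallJLMS1964, Thm. 3] [cite: KervaireMilnorAnnals1963, Thm. 1.1] [cite: Kirby1989, Ch. X pp. 55–56] -/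
theorem exists_isStabilization_sphere_of_homotopySphere_four_of_thetaFour_of_isOdd_twist
    (hΘ : isHCobordant_sphere_of_homotopySphere_four)
    (hodd : ∀ (V : Type) [TopologicalSpace V] [T2Space V] [SecondCountableTopology V] [CompactSpace V]
      [ChartedSpace (EuclideanSpace ℝ (Fin 4)) V] [IsManifold (𝓡 4) ∞ V] [SimplyConnectedSpace V] (C : StdChart V),
      ∃ μ' : HomologicalOrientation ℤ (C.nbhd.linTwist OpLoop.twist).Surgered 4,
        (intersectionForm two_add_two_eq_four μ').IsOdd)
    (S : HomotopySphere 4) :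
    ∃ (k : ℕ) (P : Type) (_ : TopologicalSpace P) (_ : T2Space P)
      (_ : SecondCountableTopology P) (_ : ChartedSpace (EuclideanSpace ℝ (Fin 4)) P) (_ : CompactSpace P)
      (_ : IsManifold (𝓡 4) ∞ P),
      IsStabilization k S.carrier P ∧ IsStabilization k (Metric.sphere (0 : EuclideanSpace ℝ (Fin 5)) 1) P := by
  haveI : SimplyConnectedSpace (Metric.sphere (0 : EuclideanSpace ℝ (Fin 5)) 1) :=
    simplyConnectedSpace_sphere_four_holds
  obtain ⟨e⟩ := S.nonempty_homotopyEquiv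
  haveI : SimplyConnectedSpace S.carrier := e.simplyConnectedSpace
  haveI := HomotopySphere.subsingleton_freeCohomology_two S
  haveI := subsingleton_freeCohomology_two_sphere_four
  exact exists_isStabilization_of_isHCobordant_of_isEven_of_isOdd_twist hodd
    (fun μ => isEven_intersectionForm_of_subsingleton_freeCohomology μ)
    (fun μ => isEven_intersectionForm_of_subsingleton_freeCohomology μ) (hΘ S)

/-- **`StableBarrierFour` GIVEN `Θ₄ = 0` and the oddness of the twisted surgery**: a stable
invariant `I` takes the value `I S⁴` on every homotopy 4-sphere `Σ`, since some closed smooth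
`P` is a `k`-fold stabilisation of both
(`exists_isStabilization_sphere_of_homotopySphere_four_of_thetaFour_of_isOdd_twist`).  Relative
to `stableBarrierFour_of_wall` (Wall's Thm. 3 + `Θ₄ = 0` + `π₁(S⁴) = 1`) the input from Wall's
theorem is reduced to the single local statement `hodd`. [cite: WallJLMS1964, Thm. 3] [cite: KervaireMilnorAnnals1963, Thm. 1.1] [cite: Reutter2023SemisimpleTFT, §1.1 Thm. 1 and Cor. 2] -/
theorem stableBarrierFour_of_thetaFour_of_isOdd_twist
    (hΘ : isHCobordant_sphere_of_homotopySphere_four)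
    (hodd : ∀ (V : Type) [TopologicalSpace V] [T2Space V] [SecondCountableTopology V] [CompactSpace V]
      [ChartedSpace (EuclideanSpace ℝ (Fin 4)) V] [IsManifold (𝓡 4) ∞ V] [SimplyConnectedSpace V] (C : StdChart V),
      ∃ μ' : HomologicalOrientation ℤ (C.nbhd.linTwist OpLoop.twist).Surgered 4,
        (intersectionForm two_add_two_eq_four μ').IsOdd) :
    StableBarrierFour.{u} := by
  intro α I hI S
  obtain ⟨k, P, _, _, _, _, _, _, hSP, h4P⟩ :=
    exists_isStabilization_sphere_of_homotopySphere_four_of_thetaFour_of_isOdd_twist hΘ hodd S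
  haveI : SimplyConnectedSpace (Metric.sphere (0 : EuclideanSpace ℝ (Fin 5)) 1) :=
    simplyConnectedSpace_sphere_four_holds
  obtain ⟨e⟩ := S.nonempty_homotopyEquiv
  haveI : SimplyConnectedSpace S.carrier := e.simplyConnectedSpace
  exact hI k S.carrier (Metric.sphere (0 : EuclideanSpace ℝ (Fin 5)) 1) P hSP h4P

end Literature.Barriers.SmoothPoincare4

end
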